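import Mathlib.MeasureTheory.Constructions.HaarToSphere
import Mathlib.MeasureTheory.Measure.Lebesgue.VolumeOfBalls
import Mathlib.Analysis.SpecialFunctions.ImproperIntegrals
import Mathlib.MeasureTheory.Integral.IntegralEqImproper
import Mathlib.Analysis.SpecialFunctions.Integrals.Basic
import Literature.Analysis.FluidPDE.BurgersVortex
import Literature.Analysis.FluidPDE.StrainedAzimuthalFlow
import HarnessLib

/-!
# The Burgers vortex: steady Navier–Stokes solution, dissipation and core energy (proofs)

Analysis/FluidPDE proofs file (work item `defn-BurgersVortexInStrain`; all results proved, no named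
facts).

## 1. Steady solution

We prove the classical statement (Burgers 1948; Frisch 1995, §8.9.1: "it is then easily checked
that an exact solution with vanishing nonlinearity is the Burgers vortex (8.140)"; Gallay–Maekawa
2016, (1.21)): for every viscosity `ν ≠ 0`, strain rate `γ` and circulation `Γ`, the field
`u = burgersVortex γ ν Γ = axisymmetricStrain γ + burgersVortexSwirl γ ν Γ`, together with the
pressure

  `p(x) = −½|U_s(x)|² + ½ Q(x₀² + x₁²)`,  `Q(σ) = ∫₀^σ q(τ)² dτ`,  `q(σ) = (γΓ/8πν) φ(γσ/4ν)`

(`burgersVortexPressure`), is a steady classical solution of the unforced Navier–Stokes equations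
on `ℝ³` (`burgersVortex_isSteadyClassicalNS`), whence
`burgersVortexInStrain : IsSteadyNSInStrain ν (axisymmetricStrain γ) (burgersVortexSwirl γ ν Γ)`;
its vorticity is the Gaussian `ω e_z`, `ω = burgersVorticity γ ν Γ` of (8.140)
(`curl_burgersVortex`), and the swirl decays like the point vortex, `|v| ≤ |Γ|/(2πr)`
(`norm_burgersVortexSwirl_le`).

By `StrainedAzimuthal.isSteadyClassicalNS_azimuthal` it suffices that the profile
`q(σ) = cφ(aσ)`, `a = γ/(4ν)`, solves `4ν(σq'' + 2q') + γ(q + σq') = 0`; with `4νa = γ` this is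
`tφ''(t) + (2 + t)φ'(t) + φ(t) = 0` at `t = aσ` (`burgersPhi_ode`), obtained by differentiating
`tφ(t) = 1 − e^{−t}` (`mul_burgersPhi`) twice. The physical case is `γ, ν > 0`; the identity is
algebraic and holds for all signs.

## 2. Dissipation per unit length

For `γ, ν > 0` we compute the pointwise squared Frobenius norm of the velocity gradient of the
swirl `v = burgersVortexSwirl γ ν Γ`,

  `|∇v(x)|² = 2c² ((tφ'(t))² + e^{−2t})`,  `t = γ(x₀² + x₁²)/(4ν)`, `c = γΓ/(8πν)`

(`frobeniusNormSq_fderiv_burgersVortexSwirl`; for a general azimuthal field `q(ρ)Jx` it is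
`4ρ²q'² + 4ρqq' + 2q²`, `frobeniusNormSq_fderiv_azimuthal`), the profile integral
`∫₀^∞ (tφ'(t))² dt = 1/2` (`integral_sq_mul_deriv_burgersPhi`, by `tφ' = e^{−t} − φ` and
`(tφ²)' = 2φe^{−t} − φ²`), the radial integration formula
`∫_{ℝ²} G(a|y|²) dy = (π/a) ∫₀^∞ G` (`integral_comp_mul_norm_sq`), and conclude the classical
**dissipation per unit length of the tube**

  `ν ∫_{ℝ²} |∇v(y, c)|² dy = γΓ²/(8π)`      (`burgersVortex_dissipation`),

independent of the viscosity and of the height `c` (Burgers 1948; it coincides with the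
enstrophy form `ν∫ω² = γΓ²/(8π)` of `burgersVortex_enstrophy_dissipation`, the difference
`|∇v|² − ω² = −2(ρq²)'` integrating to zero). The strain `U_s` itself has the constant
dissipation density `ν|∇U_s|² = 3νγ²/2` per unit volume and is not included.

## 3. Kinetic energy outside the core

For `γ, ν > 0` (core radius `δ = (ν/γ)^{1/2} = burgersCoreRadius γ ν`) the kinetic energy per unit
length of the tube carried by the annulus `r₁ < r < r₂` of a cross-section,

  `E(r₁, r₂) = ∫_{r₁ < |y| < r₂} ½ |v(y, c)|² dy`     (`burgersAnnulusEnergy`),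

is computed exactly in terms of the profile (`burgersAnnulusEnergy_eq`):

  `E(r₁, r₂) = (Γ²/8π) ∫_{a r₁²}^{a r₂²} t φ(t)² dt`,  `a = γ/(4ν)`,  `tφ(t)² = (1 − e^{−t})²/t`,

and since `1/t − 8e^{−t} ≤ tφ(t)² ≤ 1/t` for `t ≥ 1/4 = aδ²` we obtain the classical
**logarithmic energy of the potential-vortex tail** with an explicit `O(Γ²)` remainder
(`burgersAnnulusEnergy_le`, `burgersAnnulusEnergy_ge`, `abs_burgersAnnulusEnergy_sub_log_le`):
for every `ℓ ≥ δ`,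

  `(Γ²/4π) log(ℓ/δ) − Γ²/π ≤ E(δ, ℓ) ≤ (Γ²/4π) log(ℓ/δ)`

(the upper bound is the energy of the point vortex `Γ/(2πr)` in the same annulus; the deficit is
at most `Γ²/π`, uniformly in `ℓ`, `γ`, `ν`).

## References

* J. M. Burgers, *A mathematical model illustrating the theory of turbulence*, Adv. Appl. Mech. 1
  (1948) 171–199.
* U. Frisch, *Turbulence* (1995), §8.9.1, eq. (8.140). [Frisch1995]
* Th. Gallay, Y. Maekawa, arXiv:1610.08384, (1.19)–(1.22). [GallayMaekawa2016]
* A. J. Majda, A. L. Bertozzi, *Vorticity and Incompressible Flow* (2002), §1.2 (1.28)–(1.29)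
  (kinetic energy `½∫|v|²`, dissipation `ν∫|∇v|²`). [MajdaBertozzi2002]
-/

noncomputable section

open Set Function Filter Topology WithLp MeasureTheory InnerProductSpace Metric
open scoped Laplacian RealInnerProductSpace ContDiff

namespace Literature.Analysis.FluidPDE

/-- Local notation for physical space `ℝ³ = EuclideanSpace ℝ (Fin 3)`. -/
local notation "ℝ³" => EuclideanSpace ℝ (Fin 3)
/-- Local notation for the cross-section plane `ℝ² = EuclideanSpace ℝ (Fin 2)`. -/
local notation "ℝ²" => EuclideanSpace ℝ (Fin 2)

/-! ## 1. The steady solution -/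

namespace StrainedAzimuthal

/-! ### The ODE of the profile function `φ` -/

/-- `φ` is differentiable with derivative `deriv φ`. [folklore] -/
theorem hasDerivAt_burgersPhi (t : ℝ) : HasDerivAt burgersPhi (deriv burgersPhi t) t :=
  ((contDiff_burgersPhi (n := 1)).differentiable one_ne_zero t).hasDerivAt

/-- `deriv φ` is smooth. [folklore] -/
theorem contDiff_deriv_burgersPhi : ContDiff ℝ ∞ (deriv burgersPhi) :=
  (contDiff_infty_iff_deriv.1 (contDiff_burgersPhi (n := ∞))).2

/-- `deriv φ` is differentiable with derivative `deriv (deriv φ)`. [folklore] -/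
theorem hasDerivAt_deriv_burgersPhi (t : ℝ) :
    HasDerivAt (deriv burgersPhi) (deriv (deriv burgersPhi) t) t :=
  ((contDiff_infty_iff_deriv.1 contDiff_deriv_burgersPhi).1 t).hasDerivAt

/-- First derivative identity: `φ(t) + tφ'(t) = e^{−t}` (differentiate `tφ(t) = 1 − e^{−t}`). [folklore] -/
theorem burgersPhi_add_mul_deriv (t : ℝ) :
    burgersPhi t + t * deriv burgersPhi t = Real.exp (-t) := by
  have h1 : HasDerivAt (fun s => s * burgersPhi s) (1 * burgersPhi t + t * deriv burgersPhi t) t :=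
    (hasDerivAt_id t).fun_mul (hasDerivAt_burgersPhi t)
  have h2 : HasDerivAt (fun s => 1 - Real.exp (-s)) (-(Real.exp (-t) * -1)) t :=
    ((hasDerivAt_neg t).exp).const_sub 1
  have hfun : (fun s => s * burgersPhi s) = fun s => 1 - Real.exp (-s) := funext mul_burgersPhi
  rw [hfun] at h1
  have := h1.unique h2
  linarith

/-- Second derivative identity: `2φ'(t) + tφ''(t) = −e^{−t}`. [folklore] -/
theorem two_mul_deriv_add_mul_deriv_deriv_burgersPhi (t : ℝ) :
    2 * deriv burgersPhi t + t * deriv (deriv burgersPhi) t = -Real.exp (-t) := by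
  have h1 : HasDerivAt (fun s => burgersPhi s + s * deriv burgersPhi s)
      (deriv burgersPhi t + (1 * deriv burgersPhi t + t * deriv (deriv burgersPhi) t)) t :=
    (hasDerivAt_burgersPhi t).fun_add ((hasDerivAt_id t).fun_mul (hasDerivAt_deriv_burgersPhi t))
  have h2 : HasDerivAt (fun s => Real.exp (-s)) (Real.exp (-t) * -1) t := (hasDerivAt_neg t).exp
  have hfun : (fun s => burgersPhi s + s * deriv burgersPhi s) = fun s => Real.exp (-s) :=
    funext burgersPhi_add_mul_deriv
  rw [hfun] at h1
  have := h1.unique h2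
  linarith

/-- **The profile ODE**: `tφ''(t) + (2 + t)φ'(t) + φ(t) = 0` for all `t`. [folklore] -/
theorem burgersPhi_ode (t : ℝ) :
    t * deriv (deriv burgersPhi) t + (2 + t) * deriv burgersPhi t + burgersPhi t = 0 := by
  have h1 := burgersPhi_add_mul_deriv t
  have h2 := two_mul_deriv_add_mul_deriv_deriv_burgersPhi t
  linarith

/-! ### The Burgers vortex -/

section Burgers

/-- The two-parameter Burgers profile `q(σ) = c φ(aσ)`; the Burgers vortex has
`c = γΓ/(8πν)`, `a = γ/(4ν)`. [folklore] -/
def burgersProfile (c a : ℝ) (σ : ℝ) : ℝ :=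
  c * burgersPhi (a * σ)

/-- First derivative of the Burgers profile. [folklore] -/
def burgersProfileD (c a : ℝ) (σ : ℝ) : ℝ :=
  c * (deriv burgersPhi (a * σ) * a)

/-- Second derivative of the Burgers profile. [folklore] -/
def burgersProfileDD (c a : ℝ) (σ : ℝ) : ℝ :=
  c * (deriv (deriv burgersPhi) (a * σ) * a * a)

/-- The Burgers profile is smooth. [folklore] -/
theorem contDiff_burgersProfile (c a : ℝ) : ContDiff ℝ ∞ (burgersProfile c a) :=
  contDiff_const.mul (contDiff_burgersPhi.comp (contDiff_const.mul contDiff_id))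

/-- `q' = burgersProfileD`. [folklore] -/
theorem hasDerivAt_burgersProfile (c a σ : ℝ) :
    HasDerivAt (burgersProfile c a) (burgersProfileD c a σ) σ := by
  have hlin : HasDerivAt (fun σ : ℝ => a * σ) a σ := by simpa using (hasDerivAt_id σ).const_mul a
  exact ((hasDerivAt_burgersPhi (a * σ)).comp σ hlin).const_mul c

/-- `q'' = burgersProfileDD`. [folklore] -/
theorem hasDerivAt_burgersProfileD (c a σ : ℝ) :
    HasDerivAt (burgersProfileD c a) (burgersProfileDD c a σ) σ := by
  have hlin : HasDerivAt (fun σ : ℝ => a * σ) a σ := by simpa using (hasDerivAt_id σ).const_mul a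
  exact (((hasDerivAt_deriv_burgersPhi (a * σ)).comp σ hlin).mul_const a).const_mul c

/-- **The Burgers profile solves the strained azimuthal ODE** `4ν(σq'' + 2q') + γ(q + σq') = 0`
when `4νa = γ` (any amplitude `c`): this is `tφ'' + (2 + t)φ' + φ = 0` at `t = aσ`. [folklore] -/
theorem burgersProfile_ode {ν γ a : ℝ} (ha : 4 * ν * a = γ) (c σ : ℝ) :
    4 * ν * (σ * burgersProfileDD c a σ + 2 * burgersProfileD c a σ) +
      γ * (burgersProfile c a σ + σ * burgersProfileD c a σ) = 0 := by
  rw [← ha]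
  unfold burgersProfile burgersProfileD burgersProfileDD
  linear_combination (4 * ν * a * c) * burgersPhi_ode (a * σ)

/-- The Burgers swirl is the azimuthal field of the Burgers profile with `c = γΓ/(8πν)`,
`a = γ/(4ν)`. [folklore] -/
theorem burgersVortexSwirl_eq_azimuthal (γ ν Γ : ℝ) :
    burgersVortexSwirl γ ν Γ =
      azimuthal (burgersProfile (γ * Γ / (8 * Real.pi * ν)) (γ / (4 * ν))) := by
  funext x
  simp only [burgersVortexSwirl, azimuthal, burgersProfile, rho_apply]
  congr 2
  ring

/-- **The vorticity of an azimuthal field** `v = q(ρ)Jx` is axial: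
`curl v = (2ρq'(ρ) + 2q(ρ)) e₂` (`ω_z = ∂₀v₁ − ∂₁v₀ = r⁻¹∂ᵣ(r v_θ)`, `ω_r = ω_θ = 0`). [folklore] -/
theorem curl_azimuthal {q q' : ℝ → ℝ} (hq : ∀ σ, HasDerivAt q (q' σ) σ) (x : ℝ³) :
    curl (azimuthal q) x = (2 * rho x * q' (rho x) + 2 * q (rho x)) • EuclideanSpace.single 2 1 := by
  ext i
  fin_cases i <;> simp [curl, fderiv_azimuthal_apply hq, rotGen, rho_apply]
  ring

/-- Adding a (diagonal) linear strain does not change the curl. [folklore] -/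
theorem curl_linearStrain_add (γ₁ γ₂ γ₃ : ℝ) {v : ℝ³ → ℝ³} {x : ℝ³} (hv : DifferentiableAt ℝ v x) :
    curl (linearStrain γ₁ γ₂ γ₃ + v) x = curl v x := by
  have hdU : DifferentiableAt ℝ (linearStrain γ₁ γ₂ γ₃) x :=
    (hasFDerivAt_linearStrain _ _ _ x).differentiableAt
  have hD : fderiv ℝ (linearStrain γ₁ γ₂ γ₃ + v) x = linearStrainL γ₁ γ₂ γ₃ + fderiv ℝ v x := by
    rw [fderiv_add hdU hv, (hasFDerivAt_linearStrain _ _ _ x).fderiv]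
  ext i
  fin_cases i <;> simp [curl, hD, linearStrain]

/-- For the Burgers profile, `2ρq' + 2q = 2c e^{−aρ}` (`φ + tφ' = e^{−t}`): the vorticity of the
Burgers swirl is the Gaussian `2c e^{−aρ} e₂`. [folklore] -/
theorem curl_azimuthal_burgersProfile (c a : ℝ) (x : ℝ³) :
    curl (azimuthal (burgersProfile c a)) x = (2 * c * Real.exp (-(a * rho x))) • EuclideanSpace.single 2 1 := by
  rw [curl_azimuthal (hasDerivAt_burgersProfile c a) x, ← burgersPhi_add_mul_deriv (a * rho x)]
  simp only [burgersProfile, burgersProfileD]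
  congr 1
  ring

end Burgers

end StrainedAzimuthal

open StrainedAzimuthal

/-- `|v(x)|² = (cφ(aρ))² ρ`: the swirl has speed `|q(ρ)| r` (`|Jx| = r`). [folklore] -/
theorem norm_sq_burgersVortexSwirl (γ ν Γ : ℝ) (x : ℝ³) :
    ‖burgersVortexSwirl γ ν Γ x‖ ^ 2 =
      (γ * Γ / (8 * Real.pi * ν) * burgersPhi (γ * (x 0 ^ 2 + x 1 ^ 2) / (4 * ν))) ^ 2 *
        (x 0 ^ 2 + x 1 ^ 2) := by
  rw [burgersVortexSwirl, norm_smul, mul_pow, Real.norm_eq_abs, sq_abs]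
  congr 1
  rw [EuclideanSpace.norm_sq_eq, Fin.sum_univ_three]
  simp [sq_abs]
  ring

/-- **Decay of the swirl**: `|v(x)| ≤ |Γ|/(2πr)` off the axis (`r² = x₀² + x₁² > 0`,
`γ, ν > 0`): the Burgers swirl is dominated by the point vortex of the same circulation, since
`|v| = (|Γ|/2πr)(1 − e^{−γr²/4ν})`. In particular `v(x) → 0` like `|x_h|⁻¹` away from the axis
(the "decaying perturbation" of the strain). [folklore] -/
theorem norm_burgersVortexSwirl_le {γ ν : ℝ} (hγ : 0 < γ) (hν : 0 < ν) (Γ : ℝ) {x : ℝ³}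
    (hx : 0 < x 0 ^ 2 + x 1 ^ 2) :
    ‖burgersVortexSwirl γ ν Γ x‖ ≤ |Γ| / (2 * Real.pi * Real.sqrt (x 0 ^ 2 + x 1 ^ 2)) := by
  have hr : 0 < Real.sqrt (x 0 ^ 2 + x 1 ^ 2) := Real.sqrt_pos.2 hx
  have hρ : Real.sqrt (x 0 ^ 2 + x 1 ^ 2) ^ 2 = x 0 ^ 2 + x 1 ^ 2 := Real.sq_sqrt hx.le
  rw [← sq_le_sq₀ (norm_nonneg _) (by positivity), norm_sq_burgersVortexSwirl, div_pow, mul_pow,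
    mul_pow, hρ, sq_abs, le_div_iff₀ (by positivity)]
  -- `(cφ)² ρ · 4π²ρ ≤ Γ²`, i.e. `(Γ (tφ(t)))² ≤ Γ²` with `t = γρ/(4ν)`, `tφ = 1 − e^{−t} ∈ [0, 1]`
  have ht : 0 ≤ γ * (x 0 ^ 2 + x 1 ^ 2) / (4 * ν) := by positivity
  have hm := mul_burgersPhi (γ * (x 0 ^ 2 + x 1 ^ 2) / (4 * ν))
  have he0 : 0 < Real.exp (-(γ * (x 0 ^ 2 + x 1 ^ 2) / (4 * ν))) := Real.exp_pos _
  have he1 : Real.exp (-(γ * (x 0 ^ 2 + x 1 ^ 2) / (4 * ν))) ≤ 1 :=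
    Real.exp_le_one_iff.2 (neg_nonpos.2 ht)
  have h01 : 0 ≤ γ * (x 0 ^ 2 + x 1 ^ 2) / (4 * ν) * burgersPhi (γ * (x 0 ^ 2 + x 1 ^ 2) / (4 * ν)) ∧
      γ * (x 0 ^ 2 + x 1 ^ 2) / (4 * ν) * burgersPhi (γ * (x 0 ^ 2 + x 1 ^ 2) / (4 * ν)) ≤ 1 := by
    rw [hm]; constructor <;> linarith
  have hid : (γ * Γ / (8 * Real.pi * ν)) ^ 2 * burgersPhi (γ * (x 0 ^ 2 + x 1 ^ 2) / (4 * ν)) ^ 2 *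
      (x 0 ^ 2 + x 1 ^ 2) * ((2 * Real.pi) ^ 2 * (x 0 ^ 2 + x 1 ^ 2)) =
      Γ ^ 2 * (γ * (x 0 ^ 2 + x 1 ^ 2) / (4 * ν) * burgersPhi (γ * (x 0 ^ 2 + x 1 ^ 2) / (4 * ν))) ^ 2 := by
    field_simp
    ring
  have hsq : (γ * (x 0 ^ 2 + x 1 ^ 2) / (4 * ν) * burgersPhi (γ * (x 0 ^ 2 + x 1 ^ 2) / (4 * ν))) ^ 2 ≤ 1 := by
    nlinarith [h01.1, h01.2]
  rw [hid]
  exact mul_le_of_le_one_right (sq_nonneg Γ) hsq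

/-- **The vorticity of the Burgers vortex is `ω e_z`** with `ω = burgersVorticity γ ν Γ`
(Frisch 1995, (8.140): the vorticity `(0, 0, ω(x₁, x₂))` of the strained solution):
`curl (burgersVortex γ ν Γ) x = ω(x) e₂`; the strain is irrotational. [cite: Frisch1995, §8.9.1 eq. (8.140)] -/
theorem curl_burgersVortex (γ ν Γ : ℝ) (x : ℝ³) :
    curl (burgersVortex γ ν Γ) x = burgersVorticity γ ν Γ x • EuclideanSpace.single 2 1 := by
  have hdv : DifferentiableAt ℝ (burgersVortexSwirl γ ν Γ) x :=
    ((contDiff_burgersVortexSwirl γ ν Γ (n := 1)).differentiable one_ne_zero) x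
  rw [burgersVortex, axisymmetricStrain, curl_linearStrain_add _ _ _ hdv,
    burgersVortexSwirl_eq_azimuthal, curl_azimuthal_burgersProfile, burgersVorticity, rho_apply]
  congr 1
  rw [show -(γ / (4 * ν) * (x 0 ^ 2 + x 1 ^ 2)) = -(γ * (x 0 ^ 2 + x 1 ^ 2) / (4 * ν)) by ring]
  ring

/-- The vorticity of the swirl alone is the same Gaussian `ω e₂`. [folklore] -/
theorem curl_burgersVortexSwirl (γ ν Γ : ℝ) (x : ℝ³) :
    curl (burgersVortexSwirl γ ν Γ) x = burgersVorticity γ ν Γ x • EuclideanSpace.single 2 1 := by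
  have h := curl_burgersVortex γ ν Γ x
  have hdv : DifferentiableAt ℝ (burgersVortexSwirl γ ν Γ) x :=
    ((contDiff_burgersVortexSwirl γ ν Γ (n := 1)).differentiable one_ne_zero) x
  rwa [burgersVortex, axisymmetricStrain, curl_linearStrain_add _ _ _ hdv] at h

/-- The **pressure of the Burgers vortex**:
`p(x) = −½|U_s(x)|² + ½∫₀^{x₀²+x₁²} q(τ)² dτ` with `q(σ) = (γΓ/8πν) φ(γσ/4ν)`, i.e. the strain
pressure `−γ²(x₀² + x₁²)/8 − γ²x₂²/2` plus the cyclostrophic pressure `∫ v_θ²/r dr` of the swirl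
(not elementary: it involves exponential integrals). [folklore] -/
def burgersVortexPressure (γ ν Γ : ℝ) : EuclideanSpace ℝ (Fin 3) → ℝ :=
  pressure γ (burgersProfile (γ * Γ / (8 * Real.pi * ν)) (γ / (4 * ν)))

/-- **The Burgers vortex is an exact steady solution of the Navier–Stokes equations**
(Burgers 1948; Frisch 1995, §8.9.1, eq. (8.140); Gallay–Maekawa 2016, (1.21)): for every
viscosity `ν ≠ 0`, strain rate `γ` and circulation `Γ`, the velocity `burgersVortex γ ν Γ =
axisymmetricStrain γ + burgersVortexSwirl γ ν Γ` and the pressure `burgersVortexPressure γ ν Γ`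
are smooth on `ℝ³` and satisfy `(u·∇)u = νΔu − ∇p`, `div u = 0` pointwise. (The physical case is
`γ, ν > 0`; the identity is algebraic and holds for all signs.) [cite: Frisch1995, §8.9.1 eq. (8.140)] -/
theorem burgersVortex_isSteadyClassicalNS {ν : ℝ} (hν : ν ≠ 0) (γ Γ : ℝ) :
    IsSteadyClassicalNS ν 0 (burgersVortex γ ν Γ) (burgersVortexPressure γ ν Γ) := by
  have ha : 4 * ν * (γ / (4 * ν)) = γ := by field_simp
  have h := isSteadyClassicalNS_azimuthal (γ := γ) (contDiff_burgersProfile _ _)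
    (hasDerivAt_burgersProfile _ _) (hasDerivAt_burgersProfileD _ _)
    (burgersProfile_ode ha (γ * Γ / (8 * Real.pi * ν)))
  rw [← burgersVortexSwirl_eq_azimuthal] at h
  exact h

/-- **The Burgers vortex in strain** (Gallay–Maekawa 2016, §1: `u = u_s + v` with
`u_s = axisymmetricStrain γ`, `v` the Burgers swirl): `IsSteadyNSInStrain ν U_s v` holds for
every `ν ≠ 0`, `γ`, `Γ` — the notion requested as `BurgersVortexInStrain`. [cite: GallayMaekawa2016, §1 (1.18)–(1.22)] -/
theorem burgersVortexInStrain {ν : ℝ} (hν : ν ≠ 0) (γ Γ : ℝ) :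
    IsSteadyNSInStrain ν (axisymmetricStrain γ) (burgersVortexSwirl γ ν Γ) :=
  ⟨burgersVortexPressure γ ν Γ, burgersVortex_isSteadyClassicalNS hν γ Γ⟩

/-- The axisymmetric strain alone (`Γ = 0`: no vortex) is a steady solution. [folklore] -/
theorem isSteadyNSInStrain_axisymmetricStrain_zero {ν : ℝ} (hν : ν ≠ 0) (γ : ℝ) :
    IsSteadyNSInStrain ν (axisymmetricStrain γ) 0 := by
  have h := burgersVortexInStrain hν γ 0
  have h0 : burgersVortexSwirl γ ν 0 = 0 := by
    funext x; simp [burgersVortexSwirl]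
  rwa [h0] at h

/-! ## 2. Dissipation per unit length -/

namespace StrainedAzimuthal

/-! ### Profile integrals -/

/-- `tφ'(t) = e^{−t} − φ(t)`. [folklore] -/
theorem mul_deriv_burgersPhi (t : ℝ) : t * deriv burgersPhi t = Real.exp (-t) - burgersPhi t := by
  have := burgersPhi_add_mul_deriv t
  linarith

/-- `φ(t) ≤ 1/t` for `t > 0` (`φ = (1 − e^{−t})/t`). [folklore] -/
theorem burgersPhi_le_inv {t : ℝ} (ht : 0 < t) : burgersPhi t ≤ t⁻¹ := by
  rw [burgersPhi_of_ne_zero ht.ne', div_eq_mul_inv]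
  have : 1 - Real.exp (-t) ≤ 1 := by linarith [Real.exp_pos (-t)]
  exact mul_le_of_le_one_left (inv_nonneg.2 ht.le) this

/-- `φ(t)² ≤ 2/(1 + t²)` for `t ≥ 0` (from `φ ≤ 1` and `φ ≤ 1/t`). [folklore] -/
theorem burgersPhi_sq_le {t : ℝ} (ht : 0 ≤ t) : burgersPhi t ^ 2 ≤ 2 * (1 + t ^ 2)⁻¹ := by
  have h0 : 0 ≤ burgersPhi t := (burgersPhi_pos t).le
  have h1 : burgersPhi t ≤ 1 := burgersPhi_le_one ht
  rw [← div_eq_mul_inv, le_div_iff₀ (by positivity)]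
  rcases le_or_gt t 1 with hle | hlt
  · have : burgersPhi t ^ 2 ≤ 1 := by nlinarith
    nlinarith
  · have hi : burgersPhi t ≤ t⁻¹ := burgersPhi_le_inv (by linarith)
    have ht0 : 0 < t := by linarith
    have h2 : burgersPhi t * t ≤ 1 := by
      have := mul_le_mul_of_nonneg_right hi ht0.le
      rwa [inv_mul_cancel₀ ht0.ne'] at this
    have h3 : (burgersPhi t * t) ^ 2 ≤ 1 := by
      have h4 : 0 ≤ burgersPhi t * t := by positivity
      nlinarith
    have h5 : burgersPhi t ^ 2 ≤ 1 := by nlinarith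
    nlinarith [h3, h5]

/-- The auxiliary function `g(t) = tφ(t)²` has derivative `2φe^{−t} − φ²`. [folklore] -/
theorem hasDerivAt_mul_burgersPhi_sq (t : ℝ) :
    HasDerivAt (fun s => s * burgersPhi s ^ 2)
      (2 * burgersPhi t * Real.exp (-t) - burgersPhi t ^ 2) t := by
  have h := (hasDerivAt_id t).fun_mul ((hasDerivAt_burgersPhi t).fun_pow 2)
  refine h.congr_deriv ?_
  have hm := mul_deriv_burgersPhi t
  simp only [id, Nat.cast_ofNat]
  linear_combination (2 * burgersPhi t) * hm

/-- `tφ(t)² → 0` as `t → ∞` (`0 ≤ tφ² ≤ 1/t`). [folklore] -/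
theorem tendsto_mul_burgersPhi_sq :
    Tendsto (fun t : ℝ => t * burgersPhi t ^ 2) atTop (𝓝 0) := by
  refine tendsto_of_tendsto_of_tendsto_of_le_of_le' tendsto_const_nhds tendsto_inv_atTop_zero ?_ ?_
  · filter_upwards [eventually_ge_atTop 0] with t ht
    exact mul_nonneg ht (sq_nonneg _)
  · filter_upwards [eventually_gt_atTop 0] with t ht
    have h0 : 0 ≤ burgersPhi t := (burgersPhi_pos t).le
    have hi : burgersPhi t ≤ t⁻¹ := burgersPhi_le_inv ht
    have hm : t * burgersPhi t = 1 - Real.exp (-t) := mul_burgersPhi t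
    have hle : t * burgersPhi t ≤ 1 := by rw [hm]; linarith [Real.exp_pos (-t)]
    calc t * burgersPhi t ^ 2 = (t * burgersPhi t) * burgersPhi t := by ring
      _ ≤ 1 * burgersPhi t := mul_le_mul_of_nonneg_right hle h0
      _ ≤ t⁻¹ := by rw [one_mul]; exact hi

/-- `g' = 2φe^{−t} − φ²` is integrable on `(0, ∞)`. [folklore] -/
theorem integrableOn_deriv_mul_burgersPhi_sq :
    IntegrableOn (fun t => 2 * burgersPhi t * Real.exp (-t) - burgersPhi t ^ 2) (Ioi 0) := by
  have hc : Continuous burgersPhi := contDiff_burgersPhi (n := 0) |>.continuous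
  refine Integrable.sub ?_ ?_
  · -- `|2φe^{−t}| ≤ 2e^{−t}`
    have he : IntegrableOn (fun t => 2 * Real.exp (-1 * t)) (Ioi (0 : ℝ)) :=
      (exp_neg_integrableOn_Ioi 0 one_pos).const_mul 2
    refine he.mono' ((by fun_prop : Continuous fun t => 2 * burgersPhi t * Real.exp (-t))
      |>.aestronglyMeasurable) ?_
    refine (ae_restrict_mem measurableSet_Ioi).mono fun t ht => ?_
    have h0 : 0 ≤ burgersPhi t := (burgersPhi_pos t).le
    have h1 : burgersPhi t ≤ 1 := burgersPhi_le_one (le_of_lt ht)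
    rw [Real.norm_eq_abs, abs_of_nonneg (by positivity), neg_one_mul]
    nlinarith [Real.exp_pos (-t)]
  · -- `φ² ≤ 2/(1+t²)`
    have hi : IntegrableOn (fun t : ℝ => 2 * (1 + t ^ 2)⁻¹) (Ioi (0 : ℝ)) :=
      (integrable_inv_one_add_sq.const_mul 2).integrableOn
    refine hi.mono' ((hc.pow 2).aestronglyMeasurable) ?_
    refine (ae_restrict_mem measurableSet_Ioi).mono fun t ht => ?_
    rw [Real.norm_eq_abs, abs_of_nonneg (sq_nonneg _)]
    exact burgersPhi_sq_le (le_of_lt ht)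

/-- `∫₀^∞ (2φe^{−t} − φ²) dt = [tφ²]₀^∞ = 0`. [folklore] -/
theorem integral_deriv_mul_burgersPhi_sq :
    ∫ t in Ioi 0, (2 * burgersPhi t * Real.exp (-t) - burgersPhi t ^ 2) = 0 := by
  rw [integral_Ioi_of_hasDerivAt_of_tendsto' (fun t _ => hasDerivAt_mul_burgersPhi_sq t)
    integrableOn_deriv_mul_burgersPhi_sq tendsto_mul_burgersPhi_sq]
  simp

/-- The pointwise identity `(tφ')² = e^{−2t} − (2φe^{−t} − φ²)`. [folklore] -/
theorem sq_mul_deriv_burgersPhi (t : ℝ) :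
    (t * deriv burgersPhi t) ^ 2 =
      Real.exp (-2 * t) - (2 * burgersPhi t * Real.exp (-t) - burgersPhi t ^ 2) := by
  rw [mul_deriv_burgersPhi, show (-2 * t) = -t + -t by ring, Real.exp_add]
  ring

/-- `(tφ')²` is integrable on `(0, ∞)`. [folklore] -/
theorem integrableOn_sq_mul_deriv_burgersPhi :
    IntegrableOn (fun t => (t * deriv burgersPhi t) ^ 2) (Ioi (0 : ℝ)) := by
  simp_rw [sq_mul_deriv_burgersPhi]
  exact (exp_neg_integrableOn_Ioi 0 two_pos).sub integrableOn_deriv_mul_burgersPhi_sq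

/-- **`∫₀^∞ (tφ'(t))² dt = 1/2`**: `(tφ')² = (e^{−t} − φ)² = e^{−2t} − (tφ²)'`. [folklore] -/
theorem integral_sq_mul_deriv_burgersPhi :
    ∫ t in Ioi 0, (t * deriv burgersPhi t) ^ 2 = 1 / 2 := by
  simp_rw [sq_mul_deriv_burgersPhi]
  have he : IntegrableOn (fun t => Real.exp (-2 * t)) (Ioi (0 : ℝ)) :=
    exp_neg_integrableOn_Ioi 0 two_pos
  rw [integral_sub he integrableOn_deriv_mul_burgersPhi_sq, integral_deriv_mul_burgersPhi_sq,
    integral_exp_mul_Ioi (by norm_num : (-2 : ℝ) < 0)]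
  norm_num

/-! ### The squared gradient of an azimuthal field -/

section Profile

variable {q q' : ℝ → ℝ}

/-- **`|∇v|² = 4ρ²q'² + 4ρqq' + 2q²`** for `v = q(ρ)Jx` (squared Frobenius norm of
`Dv(x)h = 2q'(ρ)⟪x_h, h⟫Jx + q(ρ)Jh`; in polar terms `v_θ'² + (v_θ/r)²` with `v_θ = rq(r²)`). [folklore] -/
theorem frobeniusNormSq_fderiv_azimuthal (hq : ∀ σ, HasDerivAt q (q' σ) σ) (x : ℝ³) :
    frobeniusNormSq (fderiv ℝ (azimuthal q) x) =
      4 * rho x ^ 2 * q' (rho x) ^ 2 + 4 * rho x * q (rho x) * q' (rho x) + 2 * q (rho x) ^ 2 := by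
  rw [frobeniusNormSq_eq_sum (EuclideanSpace.basisFun (Fin 3) ℝ)]
  simp only [Fin.sum_univ_three, EuclideanSpace.basisFun_apply, fderiv_azimuthal_apply hq,
    EuclideanSpace.norm_sq_eq, Real.norm_eq_abs, sq_abs]
  simp [rotGen, rho_apply]
  ring

/-- For the Burgers profile (`q = cφ(aσ)`), with `t = aρ`:
`|∇v|² = 2c²((tφ'(t))² + e^{−2t})` (using `φ + tφ' = e^{−t}`). [folklore] -/
theorem frobeniusNormSq_fderiv_azimuthal_burgersProfile (c a : ℝ) (x : ℝ³) :
    frobeniusNormSq (fderiv ℝ (azimuthal (burgersProfile c a)) x) =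
      2 * c ^ 2 * ((a * rho x * deriv burgersPhi (a * rho x)) ^ 2 +
        Real.exp (-2 * (a * rho x))) := by
  rw [frobeniusNormSq_fderiv_azimuthal (hasDerivAt_burgersProfile c a) x]
  have h := burgersPhi_add_mul_deriv (a * rho x)
  rw [show (-2 * (a * rho x)) = -(a * rho x) + -(a * rho x) by ring, Real.exp_add, ← h]
  simp only [burgersProfile, burgersProfileD]
  ring

end Profile

/-! ### Radial integration on the cross-section -/

/-- **Radial integration on `ℝ²`**: `∫_{ℝ²} G(a|y|²) dy = (π/a) ∫₀^∞ G(t) dt` for `a > 0`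
(polar coordinates, `dy = 2πr dr`, `t = ar²`; both sides with Bochner junk value `0`). [folklore] -/
theorem integral_comp_mul_norm_sq (G : ℝ → ℝ) {a : ℝ} (ha : 0 < a) :
    ∫ y : ℝ², G (a * ‖y‖ ^ 2) = Real.pi / a * ∫ t in Ioi 0, G t := by
  have h1 := MeasureTheory.integral_fun_norm_addHaar (volume : Measure ℝ²) (fun r => G (a * r ^ 2))
  rw [h1, finrank_euclideanSpace_fin]
  have hball : (volume : Measure ℝ²).real (ball 0 1) = Real.pi := by
    rw [measureReal_def, EuclideanSpace.volume_ball_fin_two]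
    simp [Real.pi_pos.le]
  rw [hball]
  -- `∫₀^∞ r G(ar²) dr = (2a)⁻¹ ∫₀^∞ G`
  have hsub : ∫ r in Ioi (0 : ℝ), r ^ (2 - 1) • G (a * r ^ 2) = (2 * a)⁻¹ * ∫ t in Ioi 0, G t := by
    have h2 := integral_comp_rpow_Ioi_of_pos (g := fun u => G (a * u)) two_pos
    have h3 := integral_comp_mul_left_Ioi G 0 ha
    rw [mul_zero] at h3
    rw [h3] at h2
    have h4 : ∫ r in Ioi (0 : ℝ), r ^ (2 - 1) • G (a * r ^ 2) =
        2⁻¹ * ∫ x in Ioi (0 : ℝ), ((2 : ℝ) * x ^ ((2 : ℝ) - 1)) • G (a * x ^ (2 : ℝ)) := by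
      rw [← smul_eq_mul, ← integral_smul]
      refine setIntegral_congr_fun measurableSet_Ioi fun r hr => ?_
      have hr' : (0 : ℝ) < r := hr
      simp only [smul_eq_mul, show ((2 : ℝ) - 1) = 1 by norm_num, Real.rpow_one, Real.rpow_two]
      norm_num
      ring
    rw [h4, h2, smul_eq_mul]
    ring
  rw [hsub]
  simp only [nsmul_eq_mul, smul_eq_mul, Nat.cast_ofNat]
  field_simp

end StrainedAzimuthal

open StrainedAzimuthal

/-! ### The dissipation of the Burgers vortex -/

/-- **Pointwise squared velocity gradient of the Burgers swirl**:
`|∇v(x)|² = 2c²((tφ'(t))² + e^{−2t})` with `t = γ(x₀² + x₁²)/(4ν)`, `c = γΓ/(8πν)`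
(`|∇v|²` = `frobeniusNormSq (Dv(x))`, the tree's dissipation density). [folklore] -/
theorem frobeniusNormSq_fderiv_burgersVortexSwirl (γ ν Γ : ℝ) (x : ℝ³) :
    frobeniusNormSq (fderiv ℝ (burgersVortexSwirl γ ν Γ) x) =
      2 * (γ * Γ / (8 * Real.pi * ν)) ^ 2 *
        ((γ / (4 * ν) * (x 0 ^ 2 + x 1 ^ 2) * deriv burgersPhi (γ / (4 * ν) * (x 0 ^ 2 + x 1 ^ 2))) ^ 2 +
          Real.exp (-2 * (γ / (4 * ν) * (x 0 ^ 2 + x 1 ^ 2)))) := by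
  rw [burgersVortexSwirl_eq_azimuthal, frobeniusNormSq_fderiv_azimuthal_burgersProfile, rho_apply]

/-- **Dissipation per unit length of the Burgers vortex** (Burgers 1948): for `γ, ν > 0`, every
circulation `Γ` and every height `c`,

  `ν ∫_{ℝ²} |∇v(y, c)|² dy = γΓ²/(8π)`,

where `v = burgersVortexSwirl γ ν Γ` is the swirl (the perturbation of the strain) and
`|∇v|² = frobeniusNormSq (Dv)` is the dissipation density (Majda–Bertozzi (1.29)). The rate is
independent of the viscosity: the core radius `(ν/γ)^{1/2}` adjusts so that the strain-enhanced
gradients dissipate exactly what the strain feeds in. Proof: `|∇v|² = 2c²((tφ')² + e^{−2t})`,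
`∫_{ℝ²} G(a|y|²) = (π/a)∫₀^∞ G`, `∫₀^∞ (tφ')² = ∫₀^∞ e^{−2t} = 1/2`, and
`2πc²/a = γΓ²/(8πν)`. [folklore] -/
theorem burgersVortex_dissipation {γ ν : ℝ} (hγ : 0 < γ) (hν : 0 < ν) (Γ c : ℝ) :
    ν * ∫ y : ℝ², frobeniusNormSq (fderiv ℝ (burgersVortexSwirl γ ν Γ) (horizLift y c)) =
      γ * Γ ^ 2 / (8 * Real.pi) := by
  have ha : 0 < γ / (4 * ν) := by positivity
  set C := γ * Γ / (8 * Real.pi * ν) with hC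
  set G : ℝ → ℝ := fun t => 2 * C ^ 2 * ((t * deriv burgersPhi t) ^ 2 + Real.exp (-2 * t)) with hG
  have hpt : ∀ y : ℝ², frobeniusNormSq (fderiv ℝ (burgersVortexSwirl γ ν Γ) (horizLift y c)) =
      G (γ / (4 * ν) * ‖y‖ ^ 2) := fun y => by
    rw [frobeniusNormSq_fderiv_burgersVortexSwirl, norm_sq_eq_two, ← hC]
    simp only [horizLift_apply_zero, horizLift_apply_one, hG]
  simp_rw [hpt]
  rw [integral_comp_mul_norm_sq G ha]
  have hI : ∫ t in Ioi 0, G t = 2 * C ^ 2 := by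
    have h2 : IntegrableOn (fun t => Real.exp (-2 * t)) (Ioi (0 : ℝ)) :=
      exp_neg_integrableOn_Ioi 0 two_pos
    simp only [hG]
    rw [integral_const_mul, integral_add integrableOn_sq_mul_deriv_burgersPhi h2,
      integral_sq_mul_deriv_burgersPhi, integral_exp_mul_Ioi (by norm_num : (-2 : ℝ) < 0)]
    norm_num
  rw [hI, hC]
  field_simp
  ring

/-- **`∫_{ℝ²} |∇v|² = ∫_{ℝ²} ω²`** for the Burgers swirl on every cross-section (`γ, ν > 0`):
the dissipation and enstrophy forms of the per-unit-length rate agree (both equal `γΓ²/(8πν)`).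
[folklore] -/
theorem integral_frobeniusNormSq_fderiv_burgersVortexSwirl_eq {γ ν : ℝ} (hγ : 0 < γ) (hν : 0 < ν)
    (Γ c : ℝ) :
    ∫ y : ℝ², frobeniusNormSq (fderiv ℝ (burgersVortexSwirl γ ν Γ) (horizLift y c)) =
      ∫ y : ℝ², burgersVorticity γ ν Γ (horizLift y c) ^ 2 :=
  mul_left_cancel₀ hν.ne'
    ((burgersVortex_dissipation hγ hν Γ c).trans (burgersVortex_enstrophy_dissipation hγ hν Γ c).symm)

/-! ## 3. Kinetic energy outside the core -/

open intervalIntegral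

/-! ### The annulus energy -/

/-- The open annulus `r₁ < |y| < r₂` of the cross-section plane. [folklore] -/
def crossAnnulus (r₁ r₂ : ℝ) : Set ℝ² :=
  {y | r₁ < ‖y‖ ∧ ‖y‖ < r₂}

/-- Membership in the annulus. [folklore] -/
@[simp] theorem mem_crossAnnulus {r₁ r₂ : ℝ} {y : ℝ²} :
    y ∈ crossAnnulus r₁ r₂ ↔ r₁ < ‖y‖ ∧ ‖y‖ < r₂ := Iff.rfl

/-- The annulus is measurable. [folklore] -/
theorem measurableSet_crossAnnulus (r₁ r₂ : ℝ) : MeasurableSet (crossAnnulus r₁ r₂) := by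
  change MeasurableSet ({y : ℝ² | r₁ < ‖y‖} ∩ {y : ℝ² | ‖y‖ < r₂})
  exact (measurableSet_lt measurable_const measurable_norm).inter
    (measurableSet_lt measurable_norm measurable_const)

/-- The **kinetic energy per unit length** of the Burgers swirl `v = burgersVortexSwirl γ ν Γ` in
the annulus `r₁ < r < r₂` of the cross-section at height `c`:
`E(r₁, r₂) = ∫_{r₁ < |y| < r₂} ½|v(y, c)|² dy` (Majda–Bertozzi (1.28) restricted to the
annulus; independent of `c`). [folklore] -/
def burgersAnnulusEnergy (γ ν Γ c r₁ r₂ : ℝ) : ℝ :=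
  ∫ y in crossAnnulus r₁ r₂, 2⁻¹ * ‖burgersVortexSwirl γ ν Γ (horizLift y c)‖ ^ 2

/-- **Exact annulus energy**: for `γ, ν > 0` and `0 ≤ r₁ ≤ r₂`,
`E(r₁, r₂) = (Γ²/8π) ∫_{a r₁²}^{a r₂²} tφ(t)² dt` with `a = γ/(4ν)` (`tφ(t)² = (1 − e^{−t})²/t`,
the energy density of the profile in the variable `t = aρ`). [folklore] -/
theorem burgersAnnulusEnergy_eq {γ ν r₁ r₂ : ℝ} (hγ : 0 < γ) (hν : 0 < ν) (Γ c : ℝ)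
    (h₁ : 0 ≤ r₁) (h₁₂ : r₁ ≤ r₂) :
    burgersAnnulusEnergy γ ν Γ c r₁ r₂ =
      Γ ^ 2 / (8 * Real.pi) *
        ∫ t in (γ / (4 * ν) * r₁ ^ 2)..(γ / (4 * ν) * r₂ ^ 2), t * burgersPhi t ^ 2 := by
  have ha : 0 < γ / (4 * ν) := by positivity
  have h₂ : 0 ≤ r₂ := h₁.trans h₁₂
  have hiff : ∀ y : ℝ², y ∈ crossAnnulus r₁ r₂ ↔
      γ / (4 * ν) * ‖y‖ ^ 2 ∈ Ioo (γ / (4 * ν) * r₁ ^ 2) (γ / (4 * ν) * r₂ ^ 2) := fun y => by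
    rw [mem_crossAnnulus, mem_Ioo, mul_lt_mul_iff_right₀ ha, mul_lt_mul_iff_right₀ ha,
      sq_lt_sq₀ h₁ (norm_nonneg y), sq_lt_sq₀ (norm_nonneg y) h₂]
  -- the integrand as a function of `t = a|y|²`
  have hpt : ∀ y : ℝ²,
      (crossAnnulus r₁ r₂).indicator
          (fun y => 2⁻¹ * ‖burgersVortexSwirl γ ν Γ (horizLift y c)‖ ^ 2) y =
        (Ioo (γ / (4 * ν) * r₁ ^ 2) (γ / (4 * ν) * r₂ ^ 2)).indicator
          (fun t => (γ * Γ / (8 * Real.pi * ν)) ^ 2 / (2 * (γ / (4 * ν))) * (t * burgersPhi t ^ 2))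
          (γ / (4 * ν) * ‖y‖ ^ 2) := fun y => by
    by_cases hy : y ∈ crossAnnulus r₁ r₂
    · have ht := (hiff y).1 hy
      rw [indicator_of_mem hy, indicator_of_mem ht, norm_sq_burgersVortexSwirl]
      simp only [horizLift_apply_zero, horizLift_apply_one]
      rw [← norm_sq_eq_two, show γ * ‖y‖ ^ 2 / (4 * ν) = γ / (4 * ν) * ‖y‖ ^ 2 by ring]
      field_simp
    · have ht : γ / (4 * ν) * ‖y‖ ^ 2 ∉ Ioo (γ / (4 * ν) * r₁ ^ 2) (γ / (4 * ν) * r₂ ^ 2) :=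
        fun h => hy ((hiff y).2 h)
      rw [indicator_of_notMem hy, indicator_of_notMem ht]
  have hI : Ioi (0 : ℝ) ∩ Ioo (γ / (4 * ν) * r₁ ^ 2) (γ / (4 * ν) * r₂ ^ 2) =
      Ioo (γ / (4 * ν) * r₁ ^ 2) (γ / (4 * ν) * r₂ ^ 2) :=
    inter_eq_right.2 (Ioo_subset_Ioi_self.trans (Ioi_subset_Ioi (by positivity)))
  have hle : γ / (4 * ν) * r₁ ^ 2 ≤ γ / (4 * ν) * r₂ ^ 2 :=
    mul_le_mul_of_nonneg_left (pow_le_pow_left₀ h₁ h₁₂ 2) ha.le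
  unfold burgersAnnulusEnergy
  rw [← MeasureTheory.integral_indicator (measurableSet_crossAnnulus r₁ r₂)]
  simp_rw [hpt]
  rw [integral_comp_mul_norm_sq _ ha, setIntegral_indicator measurableSet_Ioo, hI,
    ← integral_Ioc_eq_integral_Ioo, ← intervalIntegral.integral_of_le hle,
    intervalIntegral.integral_const_mul]
  field_simp
  ring

/-! ### Bounds on the profile energy density -/

/-- `tφ(t)² ≤ 1/t` for `t > 0` (`(1 − e^{−t})² ≤ 1`). [folklore] -/
theorem mul_burgersPhi_sq_le {t : ℝ} (ht : 0 < t) : t * burgersPhi t ^ 2 ≤ t⁻¹ := by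
  have ht' : t ≠ 0 := ht.ne'
  have hm : t * burgersPhi t = 1 - Real.exp (-t) := mul_burgersPhi t
  have he : 0 < Real.exp (-t) := Real.exp_pos _
  have he1 : Real.exp (-t) ≤ 1 := Real.exp_le_one_iff.2 (neg_nonpos.2 ht.le)
  have hsq : (t * burgersPhi t) ^ 2 ≤ 1 := by
    rw [hm]
    nlinarith
  have h : t * burgersPhi t ^ 2 = t⁻¹ * (t * burgersPhi t) ^ 2 := by
    field_simp
  rw [h]
  calc t⁻¹ * (t * burgersPhi t) ^ 2 ≤ t⁻¹ * 1 := by gcongr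
    _ = t⁻¹ := mul_one _

/-- `1/t − 8e^{−t} ≤ tφ(t)²` for `t ≥ 1/4` (`(1 − e^{−t})² ≥ 1 − 2e^{−t}` and `1/t ≤ 4`). [folklore] -/
theorem mul_burgersPhi_sq_ge {t : ℝ} (ht : 1 / 4 ≤ t) :
    t⁻¹ - 8 * Real.exp (-t) ≤ t * burgersPhi t ^ 2 := by
  have ht0 : 0 < t := by linarith
  have hm : t * burgersPhi t = 1 - Real.exp (-t) := mul_burgersPhi t
  have he : 0 < Real.exp (-t) := Real.exp_pos _
  -- multiply through by `t > 0`
  rw [← sub_nonneg]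
  have key : 0 ≤ t * (t * burgersPhi t ^ 2 - (t⁻¹ - 8 * Real.exp (-t))) := by
    have h1 : t * (t * burgersPhi t ^ 2 - (t⁻¹ - 8 * Real.exp (-t))) =
        (t * burgersPhi t) ^ 2 - 1 + 8 * t * Real.exp (-t) := by
      have ht' : t ≠ 0 := ht0.ne'
      field_simp
      ring
    rw [h1, hm]
    nlinarith [mul_nonneg he.le (sub_nonneg.2 ht), sq_nonneg (Real.exp (-t))]
  exact (mul_nonneg_iff_of_pos_left ht0).1 key

/-- **Upper bound for the profile energy**: `∫_{1/4}^{M} tφ² ≤ log(4M)` for `M ≥ 1/4`. [folklore] -/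
theorem integral_mul_burgersPhi_sq_le {M : ℝ} (hM : 1 / 4 ≤ M) :
    ∫ t in (1 / 4 : ℝ)..M, t * burgersPhi t ^ 2 ≤ Real.log (4 * M) := by
  have hc : Continuous fun t => t * burgersPhi t ^ 2 :=
    continuous_id.mul ((contDiff_burgersPhi (n := 0)).continuous.pow 2)
  have hpos : ∀ x ∈ uIcc (1 / 4 : ℝ) M, 0 < x := fun x hx => by
    rw [uIcc_of_le hM] at hx
    linarith [hx.1]
  calc ∫ t in (1 / 4 : ℝ)..M, t * burgersPhi t ^ 2 ≤ ∫ t in (1 / 4 : ℝ)..M, t⁻¹ :=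
        integral_mono_on hM (hc.intervalIntegrable _ _)
          (intervalIntegrable_inv (fun x hx => (hpos x hx).ne') continuousOn_id)
          fun t ht => mul_burgersPhi_sq_le (by linarith [ht.1])
    _ = Real.log (4 * M) := by
        rw [integral_inv_of_pos (by norm_num) (by linarith), show M / (1 / 4) = 4 * M by ring]

/-- **Lower bound for the profile energy**: `log(4M) − 8 ≤ ∫_{1/4}^{M} tφ²` for `M ≥ 1/4`
(`∫_{1/4}^{M} 8e^{−t} ≤ 8e^{−1/4} ≤ 8`). [folklore] -/
theorem integral_mul_burgersPhi_sq_ge {M : ℝ} (hM : 1 / 4 ≤ M) :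
    Real.log (4 * M) - 8 ≤ ∫ t in (1 / 4 : ℝ)..M, t * burgersPhi t ^ 2 := by
  have hc : Continuous fun t => t * burgersPhi t ^ 2 :=
    continuous_id.mul ((contDiff_burgersPhi (n := 0)).continuous.pow 2)
  have hpos : ∀ x ∈ uIcc (1 / 4 : ℝ) M, 0 < x := fun x hx => by
    rw [uIcc_of_le hM] at hx
    linarith [hx.1]
  have hinv : IntervalIntegrable (fun t : ℝ => t⁻¹) volume (1 / 4) M :=
    intervalIntegrable_inv (fun x hx => (hpos x hx).ne') continuousOn_id
  have hexp : IntervalIntegrable (fun t : ℝ => 8 * Real.exp (-t)) volume (1 / 4) M :=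
    (continuous_const.mul (Real.continuous_exp.comp continuous_neg)).intervalIntegrable _ _
  have hlow : ∫ t in (1 / 4 : ℝ)..M, (t⁻¹ - 8 * Real.exp (-t)) ≤
      ∫ t in (1 / 4 : ℝ)..M, t * burgersPhi t ^ 2 :=
    integral_mono_on hM (hinv.sub hexp) (hc.intervalIntegrable _ _)
      fun t ht => mul_burgersPhi_sq_ge ht.1
  have hval : ∫ t in (1 / 4 : ℝ)..M, (t⁻¹ - 8 * Real.exp (-t)) =
      Real.log (4 * M) - 8 * (Real.exp (-(1 / 4)) - Real.exp (-M)) := by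
    rw [integral_sub hinv hexp, integral_inv_of_pos (by norm_num) (by linarith),
      show M / (1 / 4) = 4 * M by ring, intervalIntegral.integral_const_mul,
      intervalIntegral.integral_comp_neg (f := Real.exp), integral_exp]
  have hrem : 8 * (Real.exp (-(1 / 4)) - Real.exp (-M)) ≤ 8 := by
    have h1 : Real.exp (-(1 / 4 : ℝ)) ≤ 1 := Real.exp_le_one_iff.2 (by norm_num)
    have h2 : 0 < Real.exp (-M) := Real.exp_pos _
    linarith
  linarith

/-! ### The energy outside the core -/

/-- `aδ² = 1/4`: the core radius in the profile variable `t = γρ/(4ν)`. [folklore] -/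
theorem strainRate_mul_burgersCoreRadius_sq {γ ν : ℝ} (hγ : 0 < γ) (hν : 0 < ν) :
    γ / (4 * ν) * burgersCoreRadius γ ν ^ 2 = 1 / 4 := by
  rw [burgersCoreRadius_sq (div_pos hν hγ).le]
  field_simp

/-- `log(4 · aℓ²) = 2 log(ℓ/δ)`. [folklore] -/
theorem log_four_mul_strainRate_mul_sq {γ ν ℓ : ℝ} (hγ : 0 < γ) (hν : 0 < ν) (hℓ : 0 < ℓ) :
    Real.log (4 * (γ / (4 * ν) * ℓ ^ 2)) = 2 * Real.log (ℓ / burgersCoreRadius γ ν) := by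
  have hδ : 0 < burgersCoreRadius γ ν := Real.sqrt_pos.2 (div_pos hν hγ)
  have hsq : burgersCoreRadius γ ν ^ 2 = ν / γ := burgersCoreRadius_sq (div_pos hν hγ).le
  have h : 4 * (γ / (4 * ν) * ℓ ^ 2) = (ℓ / burgersCoreRadius γ ν) ^ 2 := by
    rw [div_pow, hsq]
    field_simp
  rw [h, Real.log_pow]
  norm_num

/-- **Energy outside the core, upper bound**: for `γ, ν > 0` and `ℓ ≥ δ = (ν/γ)^{1/2}`,
`E(δ, ℓ) ≤ (Γ²/4π) log(ℓ/δ)` — the swirl carries at most the energy of the point vortex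
`Γ/(2πr)` in the annulus `δ < r < ℓ`. [folklore] -/
theorem burgersAnnulusEnergy_le {γ ν ℓ : ℝ} (hγ : 0 < γ) (hν : 0 < ν) (Γ c : ℝ)
    (hℓ : burgersCoreRadius γ ν ≤ ℓ) :
    burgersAnnulusEnergy γ ν Γ c (burgersCoreRadius γ ν) ℓ ≤
      Γ ^ 2 / (4 * Real.pi) * Real.log (ℓ / burgersCoreRadius γ ν) := by
  have hδ : 0 < burgersCoreRadius γ ν := Real.sqrt_pos.2 (div_pos hν hγ)
  have hℓ0 : 0 < ℓ := hδ.trans_le hℓ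
  have hM : 1 / 4 ≤ γ / (4 * ν) * ℓ ^ 2 := by
    rw [← strainRate_mul_burgersCoreRadius_sq hγ hν]
    exact mul_le_mul_of_nonneg_left (pow_le_pow_left₀ hδ.le hℓ 2) (by positivity)
  rw [burgersAnnulusEnergy_eq hγ hν Γ c hδ.le hℓ, strainRate_mul_burgersCoreRadius_sq hγ hν]
  have hK : 0 ≤ Γ ^ 2 / (8 * Real.pi) := by positivity
  calc Γ ^ 2 / (8 * Real.pi) * ∫ t in (1 / 4 : ℝ)..(γ / (4 * ν) * ℓ ^ 2), t * burgersPhi t ^ 2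
      ≤ Γ ^ 2 / (8 * Real.pi) * Real.log (4 * (γ / (4 * ν) * ℓ ^ 2)) :=
        mul_le_mul_of_nonneg_left (integral_mul_burgersPhi_sq_le hM) hK
    _ = Γ ^ 2 / (4 * Real.pi) * Real.log (ℓ / burgersCoreRadius γ ν) := by
        rw [log_four_mul_strainRate_mul_sq hγ hν hℓ0]
        ring

/-- **Energy outside the core, lower bound**: for `γ, ν > 0` and `ℓ ≥ δ = (ν/γ)^{1/2}`,
`(Γ²/4π) log(ℓ/δ) − Γ²/π ≤ E(δ, ℓ)`. Together with `burgersAnnulusEnergy_le`: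
`E(δ, ℓ) = (Γ²/4π) log(ℓ/δ) + O(Γ²)` uniformly in `ℓ ≥ δ`, `γ`, `ν` (the kinetic energy per unit
length of the Burgers vortex in the annulus `δ < r < ℓ`). [folklore] -/
theorem burgersAnnulusEnergy_ge {γ ν ℓ : ℝ} (hγ : 0 < γ) (hν : 0 < ν) (Γ c : ℝ)
    (hℓ : burgersCoreRadius γ ν ≤ ℓ) :
    Γ ^ 2 / (4 * Real.pi) * Real.log (ℓ / burgersCoreRadius γ ν) - Γ ^ 2 / Real.pi ≤
      burgersAnnulusEnergy γ ν Γ c (burgersCoreRadius γ ν) ℓ := by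
  have hδ : 0 < burgersCoreRadius γ ν := Real.sqrt_pos.2 (div_pos hν hγ)
  have hℓ0 : 0 < ℓ := hδ.trans_le hℓ
  have hM : 1 / 4 ≤ γ / (4 * ν) * ℓ ^ 2 := by
    rw [← strainRate_mul_burgersCoreRadius_sq hγ hν]
    exact mul_le_mul_of_nonneg_left (pow_le_pow_left₀ hδ.le hℓ 2) (by positivity)
  rw [burgersAnnulusEnergy_eq hγ hν Γ c hδ.le hℓ, strainRate_mul_burgersCoreRadius_sq hγ hν]
  have hK : 0 ≤ Γ ^ 2 / (8 * Real.pi) := by positivity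
  calc Γ ^ 2 / (4 * Real.pi) * Real.log (ℓ / burgersCoreRadius γ ν) - Γ ^ 2 / Real.pi
      = Γ ^ 2 / (8 * Real.pi) * (Real.log (4 * (γ / (4 * ν) * ℓ ^ 2)) - 8) := by
        rw [log_four_mul_strainRate_mul_sq hγ hν hℓ0]
        ring
    _ ≤ Γ ^ 2 / (8 * Real.pi) * ∫ t in (1 / 4 : ℝ)..(γ / (4 * ν) * ℓ ^ 2), t * burgersPhi t ^ 2 :=
        mul_le_mul_of_nonneg_left (integral_mul_burgersPhi_sq_ge hM) hK

/-- **Two-sided form**: `|E(δ, ℓ) − (Γ²/4π) log(ℓ/δ)| ≤ Γ²/π` for all `ℓ ≥ δ`. [folklore] -/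
theorem abs_burgersAnnulusEnergy_sub_log_le {γ ν ℓ : ℝ} (hγ : 0 < γ) (hν : 0 < ν) (Γ c : ℝ)
    (hℓ : burgersCoreRadius γ ν ≤ ℓ) :
    |burgersAnnulusEnergy γ ν Γ c (burgersCoreRadius γ ν) ℓ -
        Γ ^ 2 / (4 * Real.pi) * Real.log (ℓ / burgersCoreRadius γ ν)| ≤ Γ ^ 2 / Real.pi := by
  have h1 := burgersAnnulusEnergy_le hγ hν Γ c hℓ
  have h2 := burgersAnnulusEnergy_ge hγ hν Γ c hℓ
  have h3 : 0 ≤ Γ ^ 2 / Real.pi := by positivity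
  rw [abs_le]
  constructor <;> linarith

end Literature.Analysis.FluidPDE
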